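import Literature.MathematicalPhysics.QuantumFieldTheory.CubicalCochains
import Mathlib.Algebra.BigOperators.Fin
import Mathlib.Data.Int.Interval
import HarnessLib

/-!
# Integer 2-chains on boxes of `ℤ^d`: closed 2-chains are boundaries of 3-chains inside the box

Support file for the duality transformation of four-dimensional `U(1)` lattice gauge theory
(proof programme of the named fact
`Literature.MathematicalPhysics.QuantumFieldTheory.FrohlichSpencerU1PerimeterLawD4`; the dual
representation itself is `U1DualRepresentation.lean`): the homological input
"an integer plaquette field `n` on a box with `δn = 0` is the (co)boundary of an integer field on
the cubes of the box" — Fröhlich–Spencer 1982 §2.3, Lemma 1 (the support-controlled Poincaré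
lemma), Cirigliano–Paffuti 1999 §1.2 ("on the dual form `v = *n` the constraint `δn = 0` becomes
`dv = 0` and so we can write `v = dA`") — in CHAIN language on `ℤ^d` itself (no dual lattice, any
`d`), with exact control of the cells' positions: every 3-cell of the primitive lies in the box.
The companion `CubicalCochains.lean` proves the COCHAIN statement (`H²_c(ℤ^d) = 0`, `d ≥ 3`, base
points in a box), which is a different object (under Poincaré duality it is the present statement
for `(d-2)`-chains) and controls base points only.

Chains are alternating integer tensors: a 2-chain is `M : Site d → Fin d → Fin d → ℤ` with
`M y j i = -M y i j` (the coefficient of the plaquette `(y; i<j)` is `M y i j`), a 3-chain is a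
totally alternating `Q : Site d → Fin d → Fin d → Fin d → ℤ`, a 1-chain is any
`Site d → Fin d → ℤ`. The boundary operators are the backward divergences

* `bd₂ M y k = ∑ⱼ (M (y - eⱼ) j k - M y j k)` (the coefficient of the bond `(y, k)` in `∂M`),
* `bd₃ Q y k l = ∑ⱼ (Q (y - eⱼ) j k l - Q y j k l)`,

which on the elementary cells are the oriented cubical boundaries
`∂(x; i<j) = (x,i) + (x+eᵢ,j) - (x+eⱼ,i) - (x,j)` (cf. `U1DualRepresentation`'s `plaqCurrent`).

## Main results (everything is proved; no named fact)

* `bd₂_bd₃ : bd₂ (bd₃ Q) = 0` for alternating `Q` (`∂∂ = 0`).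
* The sweep in direction `ℓ` down to the floor `a ℓ` of the box `[a, b]`: the prism operator
  `sweepH` (stack the 3-cells `(z; ℓ, j, k)` below every plaquette `(y; j, k)`, `ℓ ∉ {j,k}`, down to
  the floor) and the floor projection `sweepπ` (column sums placed on the floor), with the homotopy
  formula `eq_bd₃_sweepH_add_sweepπ : M = bd₃ (sweepH …) + sweepπ …` for CLOSED `M` supported in the
  box (for closed chains the term `h∂M` of `∂h + h∂ = 1 - π` is absent).
* `exists_bd₃_eq_of_bd₂_eq_zero` (**closed 2-chains in a box are boundaries, with supports**): an
  alternating 2-chain `M` with `bd₂ M = 0` whose plaquettes lie in the box `[a, b]`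
  (`a ≤ y`, `y + eⱼ + e_k ≤ b`) is `bd₃ Q` for a totally alternating 3-chain `Q` all of whose cubes
  lie in the box (`a ≤ y`, `y + eᵢ + eⱼ + e_k ≤ b`) — by sweeping the `d` directions in turn.

## References

* J. Fröhlich, T. Spencer, Comm. Math. Phys. 83 (1982) 411–454, §2.3, Lemma 1 (Poincaré lemma with
  supports, as recorded in the docstring of `FrohlichSpencerU1PerimeterLawD4`). [FrohlichSpencerCMP1982]
* V. Cirigliano, G. Paffuti, Comm. Math. Phys. 200 (1999) 381–398, §1.2. [CiriglianoPaffuti1999]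
-/

open Finset Function Literature.Probability.LatticeModels

noncomputable section

namespace Literature.MathematicalPhysics.QuantumFieldTheory

namespace LatticeChain

open LatticeForm (e)

variable {d : ℕ}

/-! ### Alternating tensors and the boundary operators -/

/-- A 2-chain as an alternating tensor: `M y j i = -M y i j`. [folklore] -/
def IsAlt₂ (M : Site d → Fin d → Fin d → ℤ) : Prop := ∀ y i j, M y j i = -M y i j

/-- A 3-chain as a totally alternating tensor. [folklore] -/
def IsAlt₃ (Q : Site d → Fin d → Fin d → Fin d → ℤ) : Prop :=
  (∀ y i j k, Q y j i k = -Q y i j k) ∧ ∀ y i j k, Q y i k j = -Q y i j k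

/-- Alternating 2-tensors vanish on the diagonal. [folklore] -/
theorem IsAlt₂.diag {M : Site d → Fin d → Fin d → ℤ} (h : IsAlt₂ M) (y : Site d) (i : Fin d) :
    M y i i = 0 := by
  have := h y i i; omega

/-- The zero 3-chain is alternating. [folklore] -/
theorem isAlt₃_zero : IsAlt₃ (0 : Site d → Fin d → Fin d → Fin d → ℤ) :=
  ⟨fun _ _ _ _ => by simp, fun _ _ _ _ => by simp⟩

/-- Sums of alternating 3-chains are alternating. [folklore] -/
theorem IsAlt₃.add {Q Q' : Site d → Fin d → Fin d → Fin d → ℤ} (h : IsAlt₃ Q) (h' : IsAlt₃ Q') :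
    IsAlt₃ (Q + Q') :=
  ⟨fun y i j k => by simp only [Pi.add_apply]; rw [h.1 y i j k, h'.1 y i j k]; ring,
    fun y i j k => by simp only [Pi.add_apply]; rw [h.2 y i j k, h'.2 y i j k]; ring⟩

/-- **The boundary of a 2-chain**: the coefficient `∑ⱼ (M (y - eⱼ) j k - M y j k)` of the bond
`(y, k)`. [folklore] -/
def bd₂ (M : Site d → Fin d → Fin d → ℤ) : Site d → Fin d → ℤ :=
  fun y k => ∑ j, (M (y - e j) j k - M y j k)

/-- **The boundary of a 3-chain**: the coefficient `∑ⱼ (Q (y - eⱼ) j k l - Q y j k l)` of the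
plaquette `(y; k, l)`. [folklore] -/
def bd₃ (Q : Site d → Fin d → Fin d → Fin d → ℤ) : Site d → Fin d → Fin d → ℤ :=
  fun y k l => ∑ j, (Q (y - e j) j k l - Q y j k l)

/-- `bd₂` of a difference. [folklore] -/
theorem bd₂_sub (M M' : Site d → Fin d → Fin d → ℤ) : bd₂ (M - M') = bd₂ M - bd₂ M' := by
  funext y k
  simp only [bd₂, Pi.sub_apply, ← Finset.sum_sub_distrib]
  exact Finset.sum_congr rfl fun j _ => by ring

/-- `bd₃` is additive. [folklore] -/
theorem bd₃_add (Q Q' : Site d → Fin d → Fin d → Fin d → ℤ) : bd₃ (Q + Q') = bd₃ Q + bd₃ Q' := by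
  funext y k l
  simp only [bd₃, Pi.add_apply, ← Finset.sum_add_distrib]
  exact Finset.sum_congr rfl fun j _ => by ring

/-- `bd₃ 0 = 0`. [folklore] -/
@[simp] theorem bd₃_zero : bd₃ (0 : Site d → Fin d → Fin d → Fin d → ℤ) = 0 := by
  funext y k l; simp [bd₃]

/-- The boundary of an alternating 3-chain is an alternating 2-chain. [folklore] -/
theorem isAlt₂_bd₃ {Q : Site d → Fin d → Fin d → Fin d → ℤ} (h : IsAlt₃ Q) : IsAlt₂ (bd₃ Q) := by
  intro y k l
  simp only [bd₃, ← Finset.sum_neg_distrib]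
  exact Finset.sum_congr rfl fun j _ => by rw [h.2 (y - e j) j k l, h.2 y j k l]; ring

/-- A double sum `∑ⱼ ∑ᵢ Q (f i j) i j k` with `(i,j)`-symmetric sites `f` vanishes for `Q`
antisymmetric in its first two indices. [folklore] -/
theorem sum_sum_eq_zero_of_symm {Q : Site d → Fin d → Fin d → Fin d → ℤ} (h : IsAlt₃ Q)
    (f : Fin d → Fin d → Site d) (hf : ∀ i j, f i j = f j i) (k : Fin d) :
    ∑ j, ∑ i, Q (f i j) i j k = 0 := by
  have hs : ∑ j, ∑ i, Q (f i j) i j k = -∑ j, ∑ i, Q (f i j) i j k := by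
    conv_lhs => rw [Finset.sum_comm]
    simp only [← Finset.sum_neg_distrib]
    refine Finset.sum_congr rfl fun i _ => Finset.sum_congr rfl fun j _ => ?_
    rw [hf j i, h.1 (f i j) i j k, neg_neg]
  omega

/-- **`∂∂ = 0`**: the boundary of the boundary of an alternating 3-chain vanishes. [folklore] -/
theorem bd₂_bd₃ {Q : Site d → Fin d → Fin d → Fin d → ℤ} (h : IsAlt₃ Q) : bd₂ (bd₃ Q) = 0 := by
  funext y k
  simp only [bd₂, bd₃, Pi.zero_apply, Finset.sum_sub_distrib]
  have h1 := sum_sum_eq_zero_of_symm h (fun i j => y - e j - e i)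
    (fun i j => by rw [sub_sub, sub_sub, add_comm]) k
  have h2 := sum_sum_eq_zero_of_symm h (fun _ _ => y) (fun _ _ => rfl) k
  have h3 : ∑ j, ∑ i, Q (y - e j) i j k = -∑ j, ∑ i, Q (y - e i) i j k := by
    conv_lhs => rw [Finset.sum_comm]
    simp only [← Finset.sum_neg_distrib]
    refine Finset.sum_congr rfl fun i _ => Finset.sum_congr rfl fun j _ => ?_
    rw [h.1 (y - e j) i j k, neg_neg]
  omega

/-! ### Lattice bookkeeping -/

/-- Coordinates of `y + eᵢ`. [folklore] -/
theorem add_e_apply (y : Site d) (i m : Fin d) : (y + e i) m = y m + if m = i then 1 else 0 := by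
  simp [LatticeForm.e, Pi.single_apply]

/-- Coordinates of `y - eᵢ`. [folklore] -/
theorem sub_e_apply (y : Site d) (i m : Fin d) : (y - e i) m = y m - if m = i then 1 else 0 := by
  simp [LatticeForm.e, Pi.single_apply]

/-- Resetting the `ℓ`-th coordinate erases a shift in direction `ℓ`. [folklore] -/
theorem update_sub_e_self (y : Site d) (ℓ : Fin d) (s : ℤ) : update (y - e ℓ) ℓ s = update y ℓ s := by
  ext m
  by_cases hm : m = ℓ
  · subst hm; simp
  · rw [update_of_ne hm, update_of_ne hm, sub_e_apply, if_neg hm, sub_zero]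

/-- Resetting the `ℓ`-th coordinate commutes with shifts in the other directions. [folklore] -/
theorem update_sub_e_of_ne (y : Site d) {ℓ i : Fin d} (h : i ≠ ℓ) (s : ℤ) :
    update y ℓ s - e i = update (y - e i) ℓ s := by
  ext m
  rw [sub_e_apply]
  by_cases hm : m = ℓ
  · subst hm; rw [update_self, update_self, if_neg (Ne.symm h), sub_zero]
  · rw [update_of_ne hm, update_of_ne hm, sub_e_apply]

/-- `update y ℓ (s - 1) = update y ℓ s - e ℓ`. [folklore] -/
theorem update_pred (y : Site d) (ℓ : Fin d) (s : ℤ) : update y ℓ (s - 1) = update y ℓ s - e ℓ := by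
  ext m
  rw [sub_e_apply]
  by_cases hm : m = ℓ
  · subst hm; simp
  · rw [update_of_ne hm, update_of_ne hm, if_neg hm, sub_zero]

/-- The box condition for a plaquette, coordinatewise. [folklore] -/
theorem inBox₂_iff {a b y : Site d} {j k : Fin d} :
    (a ≤ y ∧ y + e j + e k ≤ b) ↔
      ∀ m, a m ≤ y m ∧ y m + (if m = j then 1 else 0) + (if m = k then 1 else 0) ≤ b m := by
  simp only [Pi.le_def, ← forall_and]
  refine forall_congr' fun m => ?_
  rw [add_e_apply, add_e_apply]

/-- The box condition for a cube, coordinatewise. [folklore] -/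
theorem inBox₃_iff {a b y : Site d} {i j k : Fin d} :
    (a ≤ y ∧ y + e i + e j + e k ≤ b) ↔
      ∀ m, a m ≤ y m ∧
        y m + (if m = i then 1 else 0) + (if m = j then 1 else 0) + (if m = k then 1 else 0) ≤ b m := by
  simp only [Pi.le_def, ← forall_and]
  refine forall_congr' fun m => ?_
  rw [add_e_apply, add_e_apply, add_e_apply]

/-- The integer interval `(c-1, n]` is `[c, n]`. [folklore] -/
theorem Ioc_pred_eq_Icc (c n : ℤ) : Finset.Ioc (c - 1) n = Finset.Icc c n := by
  ext s; simp only [Finset.mem_Ioc, Finset.mem_Icc]; omega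

/-- `[c, n] = {c} ∪ (c, n]` for `c ≤ n`, as a sum. [folklore] -/
theorem sum_Icc_eq_add_sum_Ioc {c n : ℤ} (h : c ≤ n) (g : ℤ → ℤ) :
    ∑ s ∈ Finset.Icc c n, g s = g c + ∑ s ∈ Finset.Ioc c n, g s := by
  rw [← Finset.Ioc_insert_left h, Finset.sum_insert (by simp)]

/-- Telescoping over an integer interval: `∑_{s ∈ (m, n]} (g (s-1) - g s) = g m - g n`. [folklore] -/
theorem sum_Ioc_telescope (g : ℤ → ℤ) {m n : ℤ} (h : m ≤ n) :
    ∑ s ∈ Finset.Ioc m n, (g (s - 1) - g s) = g m - g n := by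
  obtain ⟨t, rfl⟩ : ∃ t : ℕ, n = m + t := ⟨(n - m).toNat, by omega⟩
  clear h
  induction t with
  | zero => simp
  | succ t ih =>
    have hstep : Finset.Ioc m (m + ((t + 1 : ℕ) : ℤ)) =
        insert (m + ((t + 1 : ℕ) : ℤ)) (Finset.Ioc m (m + (t : ℤ))) := by
      ext s; simp only [Finset.mem_Ioc, Finset.mem_insert, Nat.cast_succ]; omega
    have hnot : m + ((t + 1 : ℕ) : ℤ) ∉ Finset.Ioc m (m + (t : ℤ)) := by
      simp only [Finset.mem_Ioc, Nat.cast_succ]; omega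
    rw [hstep, Finset.sum_insert hnot, ih]
    push_cast
    ring_nf

/-! ### The sweep in one direction -/

section Sweep

variable (a b : Site d) (ℓ : Fin d) (M : Site d → Fin d → Fin d → ℤ)

/-- The column sum of `M(·; j, k)` strictly above `z` in direction `ℓ` (up to the top `b ℓ` of the
box), cut off below the floor `a ℓ`: the coefficient of the 3-cell `(z; ℓ, j, k)` in the prism of
`M`. [folklore] -/
def colAbove (z : Site d) (j k : Fin d) : ℤ :=
  if a ℓ ≤ z ℓ then ∑ s ∈ Finset.Ioc (z ℓ) (b ℓ), M (update z ℓ s) j k else 0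

/-- **The prism (homotopy) operator of the sweep in direction `ℓ`**: the totally alternating
3-chain stacking, below every plaquette `(y; j, k)` with `ℓ ∉ {j, k}`, the 3-cells `(z; ℓ, j, k)`
from the floor `a ℓ` up to the plaquette. [folklore] -/
def sweepH (z : Site d) (i j k : Fin d) : ℤ :=
  (if i = ℓ then colAbove a b ℓ M z j k else 0) - (if j = ℓ then colAbove a b ℓ M z i k else 0) +
    (if k = ℓ then colAbove a b ℓ M z i j else 0)

/-- **The floor projection of the sweep in direction `ℓ`**: the plaquettes not containing the
direction `ℓ`, summed along their column and placed on the floor `y ℓ = a ℓ`. [folklore] -/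
def sweepπ (y : Site d) (j k : Fin d) : ℤ :=
  if j ≠ ℓ ∧ k ≠ ℓ ∧ y ℓ = a ℓ then ∑ s ∈ Finset.Icc (a ℓ) (b ℓ), M (update y ℓ s) j k else 0

variable {a b ℓ M}

/-! #### Support consequences -/

/-- Below the floor there is nothing. [folklore] -/
theorem eq_zero_of_apply_lt (hsupp : ∀ y j k, M y j k ≠ 0 → a ≤ y ∧ y + e j + e k ≤ b)
    {y : Site d} (hy : y ℓ < a ℓ) (j k : Fin d) : M y j k = 0 := by
  by_contra hne
  have := (inBox₂_iff.1 (hsupp y j k hne) ℓ).1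
  omega

/-- Above the top there is nothing. [folklore] -/
theorem eq_zero_of_lt_apply (hsupp : ∀ y j k, M y j k ≠ 0 → a ≤ y ∧ y + e j + e k ≤ b)
    {y : Site d} (hy : b ℓ < y ℓ) (j k : Fin d) : M y j k = 0 := by
  by_contra hne
  have := (inBox₂_iff.1 (hsupp y j k hne) ℓ).2
  split_ifs at this <;> omega

/-- A plaquette containing the direction `ℓ` and based at height `b ℓ` sticks out of the box.
[folklore] -/
theorem eq_zero_top (hsupp : ∀ y j k, M y j k ≠ 0 → a ≤ y ∧ y + e j + e k ≤ b)
    {y : Site d} (hy : b ℓ ≤ y ℓ) (k : Fin d) : M y ℓ k = 0 := by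
  by_contra hne
  have := (inBox₂_iff.1 (hsupp y ℓ k hne) ℓ).2
  simp only [if_true] at this
  split_ifs at this <;> omega

/-! #### Alternation and supports of the sweep operators -/

/-- The column sums are alternating. [folklore] -/
theorem colAbove_swap (halt : IsAlt₂ M) (z : Site d) (j k : Fin d) :
    colAbove a b ℓ M z k j = -colAbove a b ℓ M z j k := by
  unfold colAbove
  split_ifs
  · rw [← Finset.sum_neg_distrib]; exact Finset.sum_congr rfl fun s _ => halt _ j k
  · simp

/-- The prism is totally alternating. [folklore] -/
theorem isAlt₃_sweepH (halt : IsAlt₂ M) : IsAlt₃ (sweepH a b ℓ M) := by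
  constructor
  · intro y i j k
    simp only [sweepH]
    rw [colAbove_swap halt y i j]
    split_ifs <;> ring
  · intro y i j k
    simp only [sweepH]
    rw [colAbove_swap halt y j k]
    split_ifs <;> ring

/-- The floor projection is alternating. [folklore] -/
theorem isAlt₂_sweepπ (halt : IsAlt₂ M) : IsAlt₂ (sweepπ a b ℓ M) := by
  intro y j k
  unfold sweepπ
  by_cases hc : j ≠ ℓ ∧ k ≠ ℓ ∧ y ℓ = a ℓ
  · have hc' : k ≠ ℓ ∧ j ≠ ℓ ∧ y ℓ = a ℓ := ⟨hc.2.1, hc.1, hc.2.2⟩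
    rw [if_pos hc, if_pos hc', ← Finset.sum_neg_distrib]
    exact Finset.sum_congr rfl fun s _ => halt _ j k
  · have hc' : ¬ (k ≠ ℓ ∧ j ≠ ℓ ∧ y ℓ = a ℓ) := fun h => hc ⟨h.2.1, h.1, h.2.2⟩
    rw [if_neg hc, if_neg hc', neg_zero]

/-- The floor projection has no component containing the swept direction. [folklore] -/
theorem sweepπ_eq_zero_left (y : Site d) (k : Fin d) : sweepπ a b ℓ M y ℓ k = 0 := by
  simp [sweepπ]

/-- The floor projection only has components that `M` has. [folklore] -/
theorem sweepπ_eq_zero_of_forall {y : Site d} {j k : Fin d} (h : ∀ s, M (update y ℓ s) j k = 0) :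
    sweepπ a b ℓ M y j k = 0 := by
  unfold sweepπ
  split_ifs
  · exact Finset.sum_eq_zero fun s _ => h s
  · rfl

/-- Support of the floor projection: its plaquettes lie in the box if those of `M` do. [folklore] -/
theorem sweepπ_supp (hsupp : ∀ y j k, M y j k ≠ 0 → a ≤ y ∧ y + e j + e k ≤ b) {y : Site d}
    {j k : Fin d} (h : sweepπ a b ℓ M y j k ≠ 0) : a ≤ y ∧ y + e j + e k ≤ b := by
  unfold sweepπ at h
  split_ifs at h with hc
  · obtain ⟨hj, hk, hy⟩ := hc
    obtain ⟨s, hs, hne⟩ := Finset.exists_ne_zero_of_sum_ne_zero h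
    have H := inBox₂_iff.1 (hsupp _ j k hne)
    rw [Finset.mem_Icc] at hs
    refine inBox₂_iff.2 fun m => ?_
    have Hm := H m
    by_cases hm : m = ℓ
    · subst hm
      rw [update_self, if_neg (Ne.symm hj), if_neg (Ne.symm hk)] at Hm
      rw [if_neg (Ne.symm hj), if_neg (Ne.symm hk), hy]
      omega
    · rwa [update_of_ne hm] at Hm
  · exact absurd rfl h

/-- Support of a non-zero column sum: the cube `(z; ℓ, j, k)` lies in the box. [folklore] -/
theorem colAbove_supp (hsupp : ∀ y j k, M y j k ≠ 0 → a ≤ y ∧ y + e j + e k ≤ b) {z : Site d}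
    {j k : Fin d} (hc : colAbove a b ℓ M z j k ≠ 0) : a ≤ z ∧ z + e ℓ + e j + e k ≤ b := by
  unfold colAbove at hc
  split_ifs at hc with hz
  · obtain ⟨s, hs, hne⟩ := Finset.exists_ne_zero_of_sum_ne_zero hc
    have H := inBox₂_iff.1 (hsupp _ j k hne)
    rw [Finset.mem_Ioc] at hs
    have Hℓ := H ℓ
    rw [update_self] at Hℓ
    refine inBox₃_iff.2 fun m => ?_
    have Hm := H m
    by_cases hm : m = ℓ
    · subst hm
      rw [if_pos rfl]
      split_ifs at Hℓ <;> omega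
    · rw [update_of_ne hm] at Hm
      rw [if_neg hm]
      omega
  · exact absurd rfl hc

/-- Support of the prism: its cubes lie in the box if the plaquettes of `M` do. [folklore] -/
theorem sweepH_supp (hsupp : ∀ y j k, M y j k ≠ 0 → a ≤ y ∧ y + e j + e k ≤ b) {z : Site d}
    {i j k : Fin d} (h : sweepH a b ℓ M z i j k ≠ 0) : a ≤ z ∧ z + e i + e j + e k ≤ b := by
  unfold sweepH at h
  have hABC : (if i = ℓ then colAbove a b ℓ M z j k else 0) ≠ 0 ∨
      (if j = ℓ then colAbove a b ℓ M z i k else 0) ≠ 0 ∨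
        (if k = ℓ then colAbove a b ℓ M z i j else 0) ≠ 0 := by
    by_contra hcon
    push Not at hcon
    obtain ⟨h1, h2, h3⟩ := hcon
    exact h (by rw [h1, h2, h3]; simp)
  rcases hABC with hA | hB | hC
  · by_cases hi : i = ℓ
    · rw [if_pos hi] at hA
      rw [hi]
      exact colAbove_supp hsupp hA
    · rw [if_neg hi] at hA; exact absurd rfl hA
  · by_cases hj : j = ℓ
    · rw [if_pos hj] at hB
      obtain ⟨h1, h2⟩ := colAbove_supp hsupp hB
      rw [hj]
      refine ⟨h1, ?_⟩
      have : z + e i + e ℓ + e k = z + e ℓ + e i + e k := by abel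
      rw [this]; exact h2
    · rw [if_neg hj] at hB; exact absurd rfl hB
  · by_cases hk : k = ℓ
    · rw [if_pos hk] at hC
      obtain ⟨h1, h2⟩ := colAbove_supp hsupp hC
      rw [hk]
      refine ⟨h1, ?_⟩
      have : z + e i + e j + e ℓ = z + e ℓ + e i + e j := by abel
      rw [this]; exact h2
    · rw [if_neg hk] at hC; exact absurd rfl hC

/-! #### The homotopy formula for closed chains -/

/-- The boundary of the prism on a plaquette not containing `ℓ`: the difference of the column sums
above `y - e_ℓ` and above `y`. [folklore] -/
theorem bd₃_sweepH_of_ne {y : Site d} {j k : Fin d} (hj : j ≠ ℓ) (hk : k ≠ ℓ) :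
    bd₃ (sweepH a b ℓ M) y j k = colAbove a b ℓ M (y - e ℓ) j k - colAbove a b ℓ M y j k := by
  simp only [bd₃, sweepH, if_neg hj, if_neg hk, sub_zero, add_zero]
  rw [Finset.sum_sub_distrib, Finset.sum_ite_eq' Finset.univ ℓ, Finset.sum_ite_eq' Finset.univ ℓ]
  simp

/-- The boundary of the prism on a plaquette containing `ℓ`: minus the sum over the other
directions `i` of the differences of the side column sums. [folklore] -/
theorem bd₃_sweepH_left {y : Site d} {k : Fin d} (hk : k ≠ ℓ) :
    bd₃ (sweepH a b ℓ M) y ℓ k =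
      -∑ i ∈ Finset.univ.erase ℓ, (colAbove a b ℓ M (y - e i) i k - colAbove a b ℓ M y i k) := by
  simp only [bd₃, sweepH, if_true, if_neg hk, add_zero]
  set g : Fin d → ℤ := fun i => colAbove a b ℓ M (y - e i) i k - colAbove a b ℓ M y i k with hg
  have h1 : ∀ i, ((if i = ℓ then colAbove a b ℓ M (y - e i) ℓ k else 0) - colAbove a b ℓ M (y - e i) i k -
      ((if i = ℓ then colAbove a b ℓ M y ℓ k else 0) - colAbove a b ℓ M y i k)) =
      (if i = ℓ then g ℓ else 0) - g i := by
    intro i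
    by_cases hi : i = ℓ
    · subst hi; simp [hg]
    · simp only [if_neg hi, hg]; ring
  rw [Finset.sum_congr rfl fun i _ => h1 i, Finset.sum_sub_distrib, Finset.sum_ite_eq' Finset.univ ℓ,
    if_pos (Finset.mem_univ ℓ), ← Finset.add_sum_erase Finset.univ g (Finset.mem_univ ℓ)]
  ring

/-- **Closedness, summed along a column**: for a closed 2-chain in the box, the coefficient of a
plaquette `(y; ℓ, k)` containing the swept direction (base point not below the floor) equals minus
the sum over `i ≠ ℓ` of the differences of the column sums of `M(·; i, k)` above `y - eᵢ` and
above `y` (the `ℓ`-terms of `∑_{s > y_ℓ} (∂M)(y|s; k) = 0` telescope to `M y ℓ k`). [folklore] -/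
theorem apply_left_eq_of_closed (hcl : bd₂ M = 0)
    (hsupp : ∀ y j k, M y j k ≠ 0 → a ≤ y ∧ y + e j + e k ≤ b) {y : Site d} (k : Fin d)
    (hy : a ℓ ≤ y ℓ) :
    M y ℓ k = -∑ i ∈ Finset.univ.erase ℓ, (colAbove a b ℓ M (y - e i) i k - colAbove a b ℓ M y i k) := by
  -- the vanishing column sum of the boundary
  have h0 : ∑ s ∈ Finset.Ioc (y ℓ) (b ℓ), ∑ i, (M (update y ℓ s - e i) i k - M (update y ℓ s) i k) = 0 :=
    Finset.sum_eq_zero fun s _ => by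
      have := congrFun (congrFun hcl (update y ℓ s)) k
      simpa only [bd₂, Pi.zero_apply] using this
  rw [Finset.sum_comm, ← Finset.add_sum_erase Finset.univ _ (Finset.mem_univ ℓ)] at h0
  -- the `ℓ`-term telescopes to `M y ℓ k`
  have hℓ : ∑ s ∈ Finset.Ioc (y ℓ) (b ℓ), (M (update y ℓ s - e ℓ) ℓ k - M (update y ℓ s) ℓ k) = M y ℓ k := by
    rcases le_or_gt (y ℓ) (b ℓ) with hyb | hyb
    · have ht := sum_Ioc_telescope (fun s => M (update y ℓ s) ℓ k) hyb
      have hrw : ∀ s, M (update y ℓ s - e ℓ) ℓ k = M (update y ℓ (s - 1)) ℓ k := fun s => by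
        rw [update_pred]
      simp_rw [hrw]
      rw [ht, update_eq_self, eq_zero_top hsupp (y := update y ℓ (b ℓ)) (by rw [update_self]) k,
        sub_zero]
    · rw [Finset.Ioc_eq_empty (by omega), Finset.sum_empty, eq_zero_top hsupp hyb.le k]
  -- the other terms are differences of column sums
  have hi : ∀ i ∈ Finset.univ.erase ℓ,
      ∑ s ∈ Finset.Ioc (y ℓ) (b ℓ), (M (update y ℓ s - e i) i k - M (update y ℓ s) i k) =
        colAbove a b ℓ M (y - e i) i k - colAbove a b ℓ M y i k := by
    intro i hi
    have hiℓ : i ≠ ℓ := Finset.ne_of_mem_erase hi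
    have hyi : (y - e i) ℓ = y ℓ := by rw [sub_e_apply, if_neg (Ne.symm hiℓ), sub_zero]
    simp only [colAbove, hyi, if_pos hy, Finset.sum_sub_distrib]
    congr 1
    exact Finset.sum_congr rfl fun s _ => by rw [update_sub_e_of_ne y hiℓ]
  rw [hℓ, Finset.sum_congr rfl hi] at h0
  omega

/-- **The homotopy formula of the sweep for closed chains**: an alternating closed 2-chain whose
plaquettes lie in the box `[a, b]` is the boundary of its prism plus its floor projection,
`M = ∂(hM) + πM`. [folklore] -/
theorem eq_bd₃_sweepH_add_sweepπ (halt : IsAlt₂ M) (hcl : bd₂ M = 0)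
    (hsupp : ∀ y j k, M y j k ≠ 0 → a ≤ y ∧ y + e j + e k ≤ b) :
    M = bd₃ (sweepH a b ℓ M) + sweepπ a b ℓ M := by
  -- components containing `ℓ` in the first slot
  have left : ∀ (y : Site d) (k : Fin d), k ≠ ℓ → M y ℓ k = bd₃ (sweepH a b ℓ M) y ℓ k := by
    intro y k hk
    rw [bd₃_sweepH_left hk]
    rcases le_or_gt (a ℓ) (y ℓ) with hy | hy
    · exact apply_left_eq_of_closed hcl hsupp k hy
    · rw [eq_zero_of_apply_lt hsupp hy]
      symm
      rw [neg_eq_zero]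
      refine Finset.sum_eq_zero fun i hi => ?_
      have hiℓ : i ≠ ℓ := Finset.ne_of_mem_erase hi
      have hyi : (y - e i) ℓ = y ℓ := by rw [sub_e_apply, if_neg (Ne.symm hiℓ), sub_zero]
      simp only [colAbove, hyi, if_neg (not_le.2 hy), sub_self]
  funext y j k
  simp only [Pi.add_apply]
  by_cases hj : j = ℓ
  · subst hj
    rw [sweepπ_eq_zero_left, add_zero]
    by_cases hk : k = j
    · subst hk
      rw [halt.diag, (isAlt₂_bd₃ (isAlt₃_sweepH halt)).diag]
    · exact left y k hk
  · by_cases hk : k = ℓ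
    · subst hk
      rw [halt y k j, (isAlt₂_bd₃ (isAlt₃_sweepH halt)) y k j, (isAlt₂_sweepπ halt) y k j,
        sweepπ_eq_zero_left, neg_zero, add_zero, left y j hj]
    · -- plaquettes not containing `ℓ`
      rw [bd₃_sweepH_of_ne hj hk]
      simp only [colAbove, sweepπ, sub_e_apply, if_true, update_sub_e_self, Ne, hj, hk,
        not_false_eq_true, true_and]
      rcases lt_trichotomy (y ℓ) (a ℓ) with hy | hy | hy
      · -- below the floor
        rw [if_neg (by omega), if_neg (by omega), if_neg (by omega), eq_zero_of_apply_lt hsupp hy]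
        simp
      · -- on the floor
        rw [if_neg (by omega), if_pos hy.ge, if_pos hy, zero_sub]
        rcases le_or_gt (a ℓ) (b ℓ) with hab | hab
        · rw [sum_Icc_eq_add_sum_Ioc hab, ← hy, update_eq_self]
          ring
        · rw [Finset.Ioc_eq_empty (by omega), Finset.Icc_eq_empty (by omega), Finset.sum_empty,
            eq_zero_of_lt_apply (ℓ := ℓ) hsupp (by omega)]
          simp
      · -- above the floor
        rw [if_pos (by omega), if_pos hy.le, if_neg (by omega), add_zero, Ioc_pred_eq_Icc]
        rcases le_or_gt (y ℓ) (b ℓ) with hyb | hyb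
        · rw [sum_Icc_eq_add_sum_Ioc hyb, update_eq_self]
          ring
        · rw [Finset.Ioc_eq_empty (by omega), Finset.Icc_eq_empty (by omega), Finset.sum_empty,
            eq_zero_of_lt_apply hsupp hyb]
          simp

/-- The floor projection of a closed chain is closed (`∂πM = ∂M - ∂∂hM = 0`). [folklore] -/
theorem bd₂_sweepπ (halt : IsAlt₂ M) (hcl : bd₂ M = 0)
    (hsupp : ∀ y j k, M y j k ≠ 0 → a ≤ y ∧ y + e j + e k ≤ b) : bd₂ (sweepπ a b ℓ M) = 0 := by
  have h := eq_bd₃_sweepH_add_sweepπ (ℓ := ℓ) halt hcl hsupp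
  have h' : sweepπ a b ℓ M = M - bd₃ (sweepH a b ℓ M) := by
    rw [eq_sub_iff_add_eq, add_comm, ← h]
  rw [h', bd₂_sub, hcl, bd₂_bd₃ (isAlt₃_sweepH halt), sub_zero]

end Sweep

/-! ### Closed 2-chains in a box are boundaries of 3-chains in the box -/

/-- Induction over the set of directions carried by the chain. [folklore] -/
theorem exists_bd₃_eq_aux (a b : Site d) (S : Finset (Fin d)) :
    ∀ M : Site d → Fin d → Fin d → ℤ, IsAlt₂ M → bd₂ M = 0 →
      (∀ y j k, M y j k ≠ 0 → a ≤ y ∧ y + e j + e k ≤ b) → (∀ y j k, M y j k ≠ 0 → j ∈ S) →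
        ∃ Q : Site d → Fin d → Fin d → Fin d → ℤ, IsAlt₃ Q ∧ bd₃ Q = M ∧
          ∀ y i j k, Q y i j k ≠ 0 → a ≤ y ∧ y + e i + e j + e k ≤ b := by
  classical
  induction S using Finset.induction_on with
  | empty =>
    intro M _ _ _ hS
    refine ⟨0, isAlt₃_zero, ?_, fun y i j k h => absurd rfl h⟩
    rw [bd₃_zero]
    funext y j k
    by_contra hne
    exact Finset.notMem_empty j (hS y j k (Ne.symm hne))
  | insert ℓ S hℓS ih =>
    intro M halt hcl hsupp hS
    have hdec := eq_bd₃_sweepH_add_sweepπ (ℓ := ℓ) halt hcl hsupp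
    have halt' := isAlt₂_sweepπ (a := a) (b := b) (ℓ := ℓ) halt
    have hcl' := bd₂_sweepπ (ℓ := ℓ) halt hcl hsupp
    have hsupp' : ∀ y j k, sweepπ a b ℓ M y j k ≠ 0 → a ≤ y ∧ y + e j + e k ≤ b :=
      fun y j k h => sweepπ_supp hsupp h
    have hS' : ∀ y j k, sweepπ a b ℓ M y j k ≠ 0 → j ∈ S := by
      intro y j k h
      have hjℓ : j ≠ ℓ := by
        rintro rfl
        exact h (sweepπ_eq_zero_left y k)
      have hj : j ∈ insert ℓ S := by
        by_contra hj'
        exact h (sweepπ_eq_zero_of_forall fun s => by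
          by_contra hne
          exact hj' (hS _ j k hne))
      exact (Finset.mem_insert.1 hj).resolve_left hjℓ
    obtain ⟨Q', hQ'alt, hQ'bd, hQ'supp⟩ := ih (sweepπ a b ℓ M) halt' hcl' hsupp' hS'
    refine ⟨sweepH a b ℓ M + Q', (isAlt₃_sweepH halt).add hQ'alt, ?_, ?_⟩
    · rw [bd₃_add, hQ'bd, ← hdec]
    · intro y i j k h
      simp only [Pi.add_apply] at h
      by_cases hH : sweepH a b ℓ M y i j k = 0
      · rw [hH, zero_add] at h
        exact hQ'supp y i j k h
      · exact sweepH_supp hsupp hH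

/-- **Closed 2-chains in a box are boundaries of 3-chains in the box** (the support-controlled
Poincaré lemma in degree two for chains; Fröhlich–Spencer 1982 Lemma 1, Cirigliano–Paffuti 1999
§1.2 "`dv = 0` and so we can write `v = dA`", in the chain language of `ℤ^d`): an alternating
integer 2-chain `M` on `ℤ^d` with `∂M = 0` all of whose plaquettes `(y; j, k)` lie in the box
`[a, b]` (`a ≤ y`, `y + eⱼ + e_k ≤ b`) is the boundary `∂Q` of a totally alternating integer
3-chain `Q` all of whose cubes lie in the same box. Proof: sweep the `d` coordinate directions in
turn (`eq_bd₃_sweepH_add_sweepπ`); each sweep removes one direction from the chain.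
[cite: FrohlichSpencerCMP1982, §2.3 Lemma 1 (Poincaré lemma with supports); CiriglianoPaffuti1999 §1.2] -/
theorem exists_bd₃_eq_of_bd₂_eq_zero (a b : Site d) (M : Site d → Fin d → Fin d → ℤ)
    (halt : IsAlt₂ M) (hcl : bd₂ M = 0)
    (hsupp : ∀ y j k, M y j k ≠ 0 → a ≤ y ∧ y + e j + e k ≤ b) :
    ∃ Q : Site d → Fin d → Fin d → Fin d → ℤ, IsAlt₃ Q ∧ bd₃ Q = M ∧
      ∀ y i j k, Q y i j k ≠ 0 → a ≤ y ∧ y + e i + e j + e k ≤ b :=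
  exists_bd₃_eq_aux a b Finset.univ M halt hcl hsupp fun _ j _ _ => Finset.mem_univ j

end LatticeChain

end Literature.MathematicalPhysics.QuantumFieldTheory
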